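import Summits.Ventures.HodgeRepro.Tier3SubspaceDescent
import Summits.Ventures.HodgeRepro.Tier3OrbitDescent

/-!
# The rational class of a Galois orbit of lines, WITHOUT an equivariant basis — LEMMA-R-RESIDUE.md §5 repaired for
the signs of coordinate wedges

Blind re-derivation cell `pub-hodge-repro`, seat `t3-p4` (Tier 3, T3.5 for T3.4).  Target tree path
`lean/Summits/Ventures/HodgeRepro/Tier3OrbitRational.lean`; imports Mathlib and the cell's `Tier3SubspaceDescent`
(Speiser's lemma) and `Tier3OrbitDescent` (`tmul_one_mem_baseChange_iff`).

WHY THIS FILE.  `Tier3OrbitDescent.exists_rational_orbit_sum` assumes a basis `e` of `K ⊗[F₀] V` with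
`(σ ⊗ 1) e_U = e_{σ • U}` EXACTLY.  For the COORDINATE WEDGES of LEMMA-R-RESIDUE.md §5 (`e_U = ∧_{(j,x) ∈ U} e_{(j,x)}`
in `H^{2p} = ∧^{2p} H¹`, built from the equivariant eigenbasis of `H¹ ⊗ F` of `Tier3EigenBasis`) the Galois action only
permutes the basis UP TO A SIGN — `(τ ⊗ 1) e_U = ± e_{τ∘U}`, the sign of the permutation that `τ` induces on the ordered
set `U` — and a stabiliser element acting by an odd permutation makes the naive orbit sum `Σ_{U ∈ G·U₀} e_U` of v5 §5
NOT Galois-fixed (e.g. the top wedge of one factor with cyclic Galois group of even order: `(τ ⊗ 1) e_U = −e_U` for a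
generator `τ`).  An equivariant basis does exist after rescaling each orbit by a Hilbert-90 element, but the conclusion
of §5 needs no rescaling at all: with the hypothesis weakened to «equivariant up to units»
`(σ ⊗ 1) e_i = u(σ, i) • e_{σ • i}`, `u(σ, i) ∈ K^×`, the `K`-span of the orbit's lines is Galois-stable, hence by
Speiser's lemma (`baseChange_rationalPart_eq`) it is the base change of its `F₀`-rational part, which is therefore
non-zero; and every non-zero rational vector of that span has a NON-ZERO coefficient on EVERY line of the orbit
(`repr_rTensor_smul_eq`: the coefficients move by `c_{σ • i} = σ(c_i) · u(σ, i)`).  That is all §5 uses: a rational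
Hodge class `η` of `B_red` whose coefficient on every reduced set `U_σ` is non-zero (`exists_rational_of_orbit_span`).

HONESTY.  Linear algebra on Mathlib over the cell's own Tier-3 modules; nothing here is about Hodge classes beyond the
abstract statement.  HC_CM is NOT proved by anyone in this repository.
-/

set_option autoImplicit false

open TensorProduct

namespace HodgeRepro.Tier3

variable {F₀ K : Type*} [Field F₀] [Field K] [Algebra F₀ K]
variable {V : Type*} [AddCommGroup V] [Module F₀ V]
variable {ι : Type*} [MulAction (K ≃ₐ[F₀] K) ι]

/-- The `K`-span of the basis vectors indexed by a Galois-stable set `O` is Galois-stable when the basis is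
equivariant up to units. -/
theorem rTensor_mem_span_image_of_equiv (e : Module.Basis ι K (K ⊗[F₀] V)) (u : (K ≃ₐ[F₀] K) → ι → K)
    (hequiv : ∀ (σ : K ≃ₐ[F₀] K) (i : ι), LinearMap.rTensor V σ.toLinearMap (e i) = u σ i • e (σ • i))
    (O : Set ι) (hO : ∀ (σ : K ≃ₐ[F₀] K), ∀ i ∈ O, σ • i ∈ O) (σ : K ≃ₐ[F₀] K) :
    ∀ w ∈ Submodule.span K (e '' O),
      LinearMap.rTensor V σ.toLinearMap w ∈ Submodule.span K (e '' O) := by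
  intro w hw
  refine Submodule.span_induction ?_ ?_ ?_ ?_ hw
  · rintro _ ⟨i, hi, rfl⟩
    rw [hequiv]
    exact Submodule.smul_mem _ _ (Submodule.subset_span ⟨σ • i, hO σ i hi, rfl⟩)
  · simp
  · intro x y _ _ hx hy
    rw [map_add]
    exact Submodule.add_mem _ hx hy
  · intro a x _ hx
    rw [rTensor_smul]
    exact Submodule.smul_mem _ _ hx

/-- `1 ⊗ v = 0` only for `v = 0` (the field extension is faithfully flat). -/
theorem tmul_one_eq_zero_iff (v : V) : (1 : K) ⊗ₜ[F₀] v = 0 ↔ v = 0 := by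
  constructor
  · intro h
    have h1 : (1 : K) ⊗ₜ[F₀] v ∈ (⊥ : Submodule F₀ V).baseChange K := by
      rw [h]; exact Submodule.zero_mem _
    exact (Submodule.mem_bot F₀).mp ((tmul_one_mem_baseChange_iff (K := K) ⊥ v).mp h1)
  · rintro rfl
    exact TensorProduct.tmul_zero _ _

/-- **Coefficients of a rational vector move along the Galois orbits**: if `(σ ⊗ 1) e_i = u(σ, i) • e_{σ • i}` then, for
a RATIONAL vector `w = 1 ⊗ v` (fixed by every `σ ⊗ 1`), `c_{σ • i} = σ(c_i) · u(σ, i)` where `c = e.repr w`. -/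
theorem repr_rTensor_smul_eq (e : Module.Basis ι K (K ⊗[F₀] V)) (u : (K ≃ₐ[F₀] K) → ι → K)
    (hequiv : ∀ (σ : K ≃ₐ[F₀] K) (i : ι), LinearMap.rTensor V σ.toLinearMap (e i) = u σ i • e (σ • i))
    (v : V) (σ : K ≃ₐ[F₀] K) (i : ι) :
    e.repr ((1 : K) ⊗ₜ[F₀] v) (σ • i) = σ (e.repr ((1 : K) ⊗ₜ[F₀] v) i) * u σ i := by
  classical
  -- the general identity `e.repr (T w) (σ • i) = σ (e.repr w i) * u σ i` for `T = σ ⊗ 1`, by `Finsupp` induction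
  have key : ∀ f : ι →₀ K,
      e.repr (LinearMap.rTensor V σ.toLinearMap (e.repr.symm f)) (σ • i) = σ (f i) * u σ i := by
    intro f
    induction f using Finsupp.induction_linear with
    | zero => simp
    | add f g hf hg =>
      simp only [map_add, Finsupp.add_apply, hf, hg, add_mul]
    | single k c =>
      rw [Module.Basis.repr_symm_single, rTensor_smul, hequiv, smul_smul, LinearEquiv.map_smul,
        Module.Basis.repr_self, Finsupp.smul_apply, Finsupp.single_apply, Finsupp.single_apply, smul_eq_mul]
      by_cases hk : k = i
      · subst hk
        simp
      · have hk' : ¬ σ • k = σ • i := fun h => hk (MulAction.injective σ h)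
        simp [hk, hk']
  have hfix : LinearMap.rTensor V σ.toLinearMap ((1 : K) ⊗ₜ[F₀] v) = (1 : K) ⊗ₜ[F₀] v := by
    simp
  have := key (e.repr ((1 : K) ⊗ₜ[F₀] v))
  rw [LinearEquiv.symm_apply_apply, hfix] at this
  exact this

variable [FiniteDimensional F₀ K] [IsGalois F₀ K]

/-- A non-zero rational vector exists in the `K`-span of the lines of a non-empty Galois-stable index set
(Speiser's lemma: the span is the base change of its rational part, which cannot be `⊥`). -/
theorem exists_ne_zero_tmul_mem_span (e : Module.Basis ι K (K ⊗[F₀] V)) (u : (K ≃ₐ[F₀] K) → ι → K)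
    (hequiv : ∀ (σ : K ≃ₐ[F₀] K) (i : ι), LinearMap.rTensor V σ.toLinearMap (e i) = u σ i • e (σ • i))
    (O : Set ι) (hO : ∀ (σ : K ≃ₐ[F₀] K), ∀ i ∈ O, σ • i ∈ O) (hne : O.Nonempty) :
    ∃ v : V, v ≠ 0 ∧ (1 : K) ⊗ₜ[F₀] v ∈ Submodule.span K (e '' O) := by
  have hU := baseChange_rationalPart_eq (Submodule.span K (e '' O))
    (rTensor_mem_span_image_of_equiv e u hequiv O hO)
  by_contra h
  have h' : ∀ v : V, v ≠ 0 → (1 : K) ⊗ₜ[F₀] v ∉ Submodule.span K (e '' O) :=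
    fun v hv0 hv => h ⟨v, hv0, hv⟩
  have hbot : ((Submodule.span K (e '' O)).restrictScalars F₀).comap (TensorProduct.mk F₀ K V 1) = ⊥ := by
    rw [Submodule.eq_bot_iff]
    intro v hv
    by_contra hv0
    exact h' v hv0 hv
  rw [hbot, Submodule.baseChange_bot] at hU
  obtain ⟨i, hi⟩ := hne
  have hmem : e i ∈ Submodule.span K (e '' O) := Submodule.subset_span ⟨i, hi, rfl⟩
  rw [← hU] at hmem
  exact e.ne_zero i ((Submodule.mem_bot K).mp hmem)

/-- **The rational class of a Galois orbit of lines** (LEMMA-R-RESIDUE.md §5 (i)–(iii), sign-robust version).  Let `e` be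
a `K`-basis of `K ⊗[F₀] V` that is Galois-equivariant UP TO UNITS (`(σ ⊗ 1) e_i = u(σ, i) • e_{σ • i}`, `u(σ, i) ≠ 0`),
`W ≤ V` an `F₀`-subspace and `P ⊆ ι` a Galois-stable set of indices with `e_i ∈ W ⊗ K` for `i ∈ P`.  Then for every
`i₀ ∈ P` there is a NON-ZERO `v ∈ W` with `1 ⊗ v` in the span of the lines of the orbit of `i₀` and with a NON-ZERO
coefficient on EVERY line of that orbit. -/
theorem exists_rational_of_orbit_span (e : Module.Basis ι K (K ⊗[F₀] V)) (u : (K ≃ₐ[F₀] K) → ι → K)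
    (hu : ∀ (σ : K ≃ₐ[F₀] K) (i : ι), u σ i ≠ 0)
    (hequiv : ∀ (σ : K ≃ₐ[F₀] K) (i : ι), LinearMap.rTensor V σ.toLinearMap (e i) = u σ i • e (σ • i))
    (W : Submodule F₀ V) (P : Set ι) (hP : ∀ (σ : K ≃ₐ[F₀] K), ∀ i ∈ P, σ • i ∈ P)
    (hPW : ∀ i ∈ P, e i ∈ W.baseChange K) (i₀ : ι) (hi₀ : i₀ ∈ P) :
    ∃ v : V, v ∈ W ∧ v ≠ 0 ∧
      (1 : K) ⊗ₜ[F₀] v ∈ Submodule.span K (e '' MulAction.orbit (K ≃ₐ[F₀] K) i₀) ∧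
      ∀ i ∈ MulAction.orbit (K ≃ₐ[F₀] K) i₀, e.repr ((1 : K) ⊗ₜ[F₀] v) i ≠ 0 := by
  classical
  set O := MulAction.orbit (K ≃ₐ[F₀] K) i₀ with hOdef
  have hO : ∀ (σ : K ≃ₐ[F₀] K), ∀ i ∈ O, σ • i ∈ O := fun σ i hi => by
    obtain ⟨τ, rfl⟩ := MulAction.mem_orbit_iff.mp hi
    rw [smul_smul]
    exact MulAction.mem_orbit i₀ (σ * τ)
  have hOP : O ⊆ P := fun i hi => by
    obtain ⟨τ, rfl⟩ := MulAction.mem_orbit_iff.mp hi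
    exact hP τ i₀ hi₀
  obtain ⟨v, hv0, hv⟩ := exists_ne_zero_tmul_mem_span e u hequiv O hO ⟨i₀, MulAction.mem_orbit_self i₀⟩
  refine ⟨v, ?_, hv0, hv, ?_⟩
  · rw [← tmul_one_mem_baseChange_iff (K := K)]
    refine (Submodule.span_le.mpr ?_) hv
    rintro _ ⟨i, hi, rfl⟩
    exact hPW i (hOP hi)
  · -- some coefficient is non-zero, and the coefficients propagate along the orbit
    have hsupp : ↑(e.repr ((1 : K) ⊗ₜ[F₀] v)).support ⊆ O := e.repr_support_subset_of_mem_span O hv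
    have hne : (e.repr ((1 : K) ⊗ₜ[F₀] v)).support.Nonempty := by
      rw [Finsupp.support_nonempty_iff]
      intro h
      have : (1 : K) ⊗ₜ[F₀] v = 0 := by
        rw [← e.repr.symm_apply_apply ((1 : K) ⊗ₜ[F₀] v), h, map_zero]
      exact hv0 ((tmul_one_eq_zero_iff v).mp this)
    obtain ⟨i₁, hi₁⟩ := hne
    have hc₁ : e.repr ((1 : K) ⊗ₜ[F₀] v) i₁ ≠ 0 := Finsupp.mem_support_iff.mp hi₁
    have hi₁O : i₁ ∈ O := hsupp hi₁
    intro i hi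
    -- `i = τ • i₁` for some `τ`
    obtain ⟨σ, rfl⟩ := MulAction.mem_orbit_iff.mp hi
    obtain ⟨σ₁, rfl⟩ := MulAction.mem_orbit_iff.mp hi₁O
    have hi' : σ • i₀ = (σ * σ₁⁻¹) • σ₁ • i₀ := by
      rw [smul_smul, mul_assoc, inv_mul_cancel, mul_one]
    rw [hi', repr_rTensor_smul_eq e u hequiv v]
    exact mul_ne_zero (fun h => hc₁ ((σ * σ₁⁻¹).injective (h.trans (map_zero _).symm))) (hu _ _)

end HodgeRepro.Tier3
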